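import Mathlib.Analysis.Convolution
import Mathlib.Analysis.SpecialFunctions.Integrals.Basic
import Mathlib.Analysis.SpecialFunctions.Trigonometric.Bounds
import Mathlib.MeasureTheory.Integral.IntegralEqImproper
import Literature.Analysis.FunctionSpaces.PlancherelL1L2
import HarnessLib

/-!
# Weiss's kernel: iterated box convolutions with Laplace transform `(sinh(s/A)/(s/A))^k`

Topic `Literature/NumberTheory/LFunctions`, namespace `Literature.NumberTheory.LFunctions.WeissKernel`.
Everything here is PROVED (definitions with bodies + theorems; no named facts).

A. Weiss, *The least prime ideal*, J. reine angew. Math. 338 (1983), Lemma 3.2, and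
Thorner–Zaman, *An explicit bound for the least prime ideal in the Chebotarev density theorem*,
ANT 11 (2017), Lemma 4.3, use the weight `Ψ = H_{2n}` whose Mellin transform is
`Ψ̂(s) = (sinh(s/A)/(s/A))^{2n}` — the `2n`-fold multiplicative convolution of the box
`(A/2)·𝟙_{[e^{−1/A}, e^{1/A}]}` — as the smoothing kernel of the mean value theorem (large sieve)
for Hecke characters behind the log-free zero-density estimate.  In logarithmic coordinates
`u = log x` this is the additive `k`-fold convolution `φ_k = φ₁ * ⋯ * φ₁` of the box
`φ₁ = (A/2)·𝟙_{[−1/A, 1/A]}`.  This file constructs it and proves Weiss's Lemma 3.2 (i)–(iii):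

* `box A`, `phi A m` (`= φ_{m+1}`, the `(m+1)`-fold convolution);
* `phi_nonneg`, `phi_le` (`0 ≤ φ ≤ A/2`), `phi_eq_zero_of_lt` (support in `[−(m+1)/A, (m+1)/A]`),
  `integrable_phi`, `integral_phi` (`∫ φ = 1`), `phi_one_eq` (the tent), `continuous_phi` (`k ≥ 2`);
* `laplaceFactor A s = sinh(s/A)/(s/A)` (`= 1` at `s = 0`) and **`integral_phi_mul_exp`**:
  `∫ φ_{m+1}(u) e^{su} du = (sinh(s/A)/(s/A))^{m+1}` for every `s ∈ ℂ` (the Laplace transform of a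
  convolution is the product: Mathlib `integral_convolution`);
* `norm_laplaceFactor_le_exp` (`|sinh(s/A)/(s/A)| ≤ e^{|Re s|/A}`, from the integral
  representation), `norm_laplaceFactor_le_div` (`≤ (A/|s|) e^{|Re s|/A}`), and the powers
  `norm_laplaceFactor_pow_le_exp`, `norm_laplaceFactor_pow_le_div` (Weiss (ii)–(iii));
* `laplaceFactor_mul_I` — on the imaginary axis `sinh(it/A)/(it/A) = sin(t/A)/(t/A)`, with the
  lower bound `one_sub_le_sin_div` (`1 − x²/6 ≤ sin x / x`), `half_le_norm_laplaceFactor_pow`;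
* `gallagher` — **Gallagher's inequality with Weiss's kernel** (Weiss Cor. 3.3, TZ Lemma 4.3 (vi)):
  `∫_{−T}^{T} |Σ_j b_j e^{−itc_j}|² dt ≤ 8π ∫_ℝ |Σ_j b_j φ_{m+1}(u − c_j)|² du` whenever
  `(m+1)T² ≤ 3A²` (Plancherel on `L¹ ∩ L²`, the tree's `integral_norm_sq_fourierIntegral_eq`, and
  `|Ψ̂(it)| ≥ 1/2` for `|t| ≤ T`); with `c_j = log N𝔫_j` this is
  `∫_{−T}^{T}|Σ b(𝔫)N𝔫^{−it}|² dt ≤ 8π ∫₀^∞ |Σ b(𝔫)Ψ(x/N𝔫)|² dx/x`.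

## References

* A. Weiss, *The least prime ideal*, J. reine angew. Math. 338 (1983), 56–94, Lemma 3.2. [folklore]
* [ThornerZaman2017] J. Thorner, A. Zaman, *An explicit bound for the least prime ideal in the
  Chebotarev density theorem*, Algebra Number Theory 11 (2017), Lemma 4.3.
-/

noncomputable section

open MeasureTheory Real Complex Set Filter
open scoped Convolution Topology FourierTransform

namespace Literature.NumberTheory.LFunctions.WeissKernel

/-! ### The box and its iterated convolutions -/

/-- The box `φ₁ = (A/2)·𝟙_{[−1/A, 1/A]}` (unit mass for `A > 0`). [cite: ThornerZaman2017, Lemma 4.3] -/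
def box (A : ℝ) : ℝ → ℝ := fun u ↦ if |u| ≤ A⁻¹ then A / 2 else 0

/-- The iterated convolutions: `phi A m = φ₁^{*(m+1)}`. [cite: ThornerZaman2017, Lemma 4.3] -/
def phi (A : ℝ) : ℕ → ℝ → ℝ
  | 0 => box A
  | m + 1 => box A ⋆ phi A m

variable {A : ℝ}

/-- The box as an indicator. [folklore] -/
theorem box_eq_indicator (A : ℝ) : box A = (Icc (-A⁻¹) A⁻¹).indicator fun _ ↦ A / 2 := by
  funext u
  simp only [box, Set.indicator_apply, mem_Icc]
  by_cases h : |u| ≤ A⁻¹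
  · rw [if_pos h, if_pos (abs_le.mp h)]
  · rw [if_neg h, if_neg (fun h' ↦ h (abs_le.mpr h'))]

/-- The box is measurable. [folklore] -/
theorem measurable_box (A : ℝ) : Measurable (box A) := by
  rw [box_eq_indicator]; exact measurable_const.indicator measurableSet_Icc

/-- `0 ≤ φ₁`. [folklore] -/
theorem box_nonneg (hA : 0 < A) (u : ℝ) : 0 ≤ box A u := by
  rw [box]; split_ifs <;> linarith

/-- `φ₁ ≤ A/2`. [folklore] -/
theorem box_le (hA : 0 < A) (u : ℝ) : box A u ≤ A / 2 := by
  rw [box]; split_ifs <;> linarith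

/-- `φ₁(u) = 0` for `|u| > 1/A`. [folklore] -/
theorem box_eq_zero (A : ℝ) {u : ℝ} (hu : A⁻¹ < |u|) : box A u = 0 := by
  rw [box, if_neg (not_le.mpr hu)]

/-- `φ₁` is integrable. [folklore] -/
theorem integrable_box (A : ℝ) : Integrable (box A) := by
  rw [box_eq_indicator]
  exact (integrableOn_const (by rw [Real.volume_Icc]; exact ENNReal.ofReal_lt_top |>.ne)).integrable_indicator
    measurableSet_Icc

/-- `∫ φ₁ = 1` (`A > 0`). [folklore] -/
theorem integral_box (hA : 0 < A) : ∫ u, box A u = 1 := by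
  rw [box_eq_indicator, MeasureTheory.integral_indicator measurableSet_Icc, setIntegral_const,
    Real.volume_real_Icc, max_eq_left (by have := inv_pos.mpr hA; linarith), smul_eq_mul]
  field_simp; ring

/-- `φ_{m+1}` is integrable. [folklore] -/
theorem integrable_phi (A : ℝ) : ∀ m, Integrable (phi A m)
  | 0 => integrable_box A
  | m + 1 => (integrable_box A).integrable_convolution _ (integrable_phi A m)

/-- `∫ φ_{m+1} = 1`. [folklore] -/
theorem integral_phi (hA : 0 < A) : ∀ m, ∫ u, phi A m u = 1
  | 0 => integral_box hA
  | m + 1 => by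
      show ∫ u, (box A ⋆ phi A m) u = 1
      rw [integral_convolution (L := ContinuousLinearMap.lsmul ℝ ℝ) (integrable_box A) (integrable_phi A m),
        integral_box hA, integral_phi hA m]
      simp

/-- Unfolding of the convolution step. [folklore] -/
theorem phi_succ_apply (A : ℝ) (m : ℕ) (x : ℝ) :
    phi A (m + 1) x = ∫ t, box A t * phi A m (x - t) := by
  show (box A ⋆ phi A m) x = _
  rw [convolution_def]; rfl

/-- `0 ≤ φ_{m+1}`. [folklore] -/
theorem phi_nonneg (hA : 0 < A) : ∀ m (u : ℝ), 0 ≤ phi A m u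
  | 0, u => box_nonneg hA u
  | m + 1, u => by
      rw [phi_succ_apply]
      exact integral_nonneg fun t ↦ mul_nonneg (box_nonneg hA t) (phi_nonneg hA m _)

/-- `φ_{m+1}(u) = 0` for `|u| > (m+1)/A`. [folklore] -/
theorem phi_eq_zero_of_lt (hA : 0 < A) : ∀ (m : ℕ) {u : ℝ}, ((m : ℝ) + 1) / A < |u| → phi A m u = 0
  | 0, u, hu => box_eq_zero A (by rw [inv_eq_one_div]; simpa using hu)
  | m + 1, u, hu => by
      rw [phi_succ_apply]
      refine integral_eq_zero_of_ae (Eventually.of_forall fun t ↦ ?_)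
      simp only [Pi.zero_apply]
      by_cases ht : A⁻¹ < |t|
      · rw [box_eq_zero A ht, zero_mul]
      · rw [phi_eq_zero_of_lt hA m ?_, mul_zero]
        rw [not_lt] at ht
        have h1 : |u| ≤ |u - t| + |t| := by
          have := abs_add_le (u - t) t; rwa [sub_add_cancel] at this
        have h2 : ((m : ℝ) + 1 + 1) / A = (m + 1) / A + A⁻¹ := by rw [inv_eq_one_div]; ring
        push_cast at hu
        rw [h2] at hu
        linarith

/-- `φ_{m+1} ≤ A/2`. [folklore] -/
theorem phi_le (hA : 0 < A) : ∀ m (u : ℝ), phi A m u ≤ A / 2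
  | 0, u => box_le hA u
  | m + 1, u => by
      rw [phi_succ_apply]
      calc ∫ t, box A t * phi A m (u - t) ≤ ∫ t, A / 2 * phi A m (u - t) := by
            refine integral_mono_of_nonneg (Eventually.of_forall fun t ↦ mul_nonneg (box_nonneg hA t)
              (phi_nonneg hA m _)) (((integrable_phi A m).comp_sub_left u).const_mul _)
              (Eventually.of_forall fun t ↦ ?_)
            exact mul_le_mul_of_nonneg_right (box_le hA t) (phi_nonneg hA m _)
        _ = A / 2 := by
            rw [MeasureTheory.integral_const_mul, integral_sub_left_eq_self (phi A m) volume u, integral_phi hA m, mul_one]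

/-- `φ_{m+1}` is a.e.-strongly measurable (indeed integrable). [folklore] -/
theorem aestronglyMeasurable_phi (A : ℝ) (m : ℕ) : AEStronglyMeasurable (phi A m) volume :=
  (integrable_phi A m).aestronglyMeasurable

/-! ### Continuity: `φ₂` is a tent, and `φ_k` is continuous for `k ≥ 2` -/

/-- **`φ₂ = φ₁ * φ₁` is the tent** `(A/2)² · max(0, min(1/A, u + 1/A) − max(−1/A, u − 1/A))`
(the length of `[−1/A, 1/A] ∩ [u − 1/A, u + 1/A]`). [folklore] -/
theorem phi_one_eq (A u : ℝ) :
    phi A 1 u = (A / 2) ^ 2 * max 0 (min A⁻¹ (u + A⁻¹) - max (-A⁻¹) (u - A⁻¹)) := by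
  rw [phi_succ_apply]
  show ∫ t, box A t * box A (u - t) = _
  have e : (fun t ↦ box A t * box A (u - t)) =
      (Icc (max (-A⁻¹) (u - A⁻¹)) (min A⁻¹ (u + A⁻¹))).indicator fun _ ↦ (A / 2) ^ 2 := by
    funext t
    rw [box_eq_indicator, Set.indicator_apply, Set.indicator_apply, Set.indicator_apply]
    simp only [mem_Icc, max_le_iff, le_min_iff]
    by_cases h1 : -A⁻¹ ≤ t ∧ t ≤ A⁻¹
    · by_cases h2 : -A⁻¹ ≤ u - t ∧ u - t ≤ A⁻¹
      · rw [if_pos h1, if_pos h2, if_pos ⟨⟨h1.1, by linarith [h2.2]⟩, h1.2, by linarith [h2.1]⟩]; ring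
      · rw [if_pos h1, if_neg h2, mul_zero, if_neg]
        rintro ⟨⟨-, h3⟩, -, h4⟩
        exact h2 ⟨by linarith, by linarith⟩
    · rw [if_neg h1, zero_mul, if_neg]
      rintro ⟨⟨h3, -⟩, h4, -⟩
      exact h1 ⟨h3, h4⟩
  rw [e, MeasureTheory.integral_indicator measurableSet_Icc, setIntegral_const, Real.volume_real_Icc,
    smul_eq_mul, mul_comm, max_comm]

/-- `φ₂` is continuous. [folklore] -/
theorem continuous_phi_one (A : ℝ) : Continuous (phi A 1) := by
  have : phi A 1 = fun u ↦ (A / 2) ^ 2 * max 0 (min A⁻¹ (u + A⁻¹) - max (-A⁻¹) (u - A⁻¹)) :=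
    funext (phi_one_eq A)
  rw [this]
  fun_prop

/-- `φ_{m+1}` has compact support. [folklore] -/
theorem hasCompactSupport_phi (hA : 0 < A) (m : ℕ) : HasCompactSupport (phi A m) := by
  refine HasCompactSupport.intro (isCompact_Icc (a := -(((m : ℝ) + 1) / A)) (b := ((m : ℝ) + 1) / A))
    fun u hu ↦ phi_eq_zero_of_lt hA m ?_
  rw [mem_Icc, ← abs_le, not_le] at hu
  exact hu

/-- **`φ_k` is continuous for `k ≥ 2`** (`φ_{k} = φ₁ * φ_{k−1}` with `φ_{k−1}` continuous of compact
support and `φ₁` locally integrable; Weiss Lemma 3.2 (i)). [cite: ThornerZaman2017, Lemma 4.3 (i)] -/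
theorem continuous_phi (hA : 0 < A) : ∀ m, 1 ≤ m → Continuous (phi A m)
  | 0, h => (Nat.not_succ_le_zero 0 h).elim
  | 1, _ => continuous_phi_one A
  | m + 2, _ => by
      show Continuous (box A ⋆ phi A (m + 1))
      exact (hasCompactSupport_phi hA (m + 1)).continuous_convolution_right _
        (integrable_box A).locallyIntegrable (continuous_phi hA (m + 1) (by omega))

/-! ### The Laplace transform -/

/-- `sinh(s/A)/(s/A)`, with the value `1` at `s = 0`. [cite: ThornerZaman2017, Lemma 4.3] -/
def laplaceFactor (A : ℝ) (s : ℂ) : ℂ := if s = 0 then 1 else Complex.sinh (s / A) / (s / A)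

/-- The twisted kernel `t ↦ φ(t) e^{st}` is integrable. [folklore] -/
theorem integrable_phi_mul_exp (hA : 0 < A) (m : ℕ) (s : ℂ) :
    Integrable fun t : ℝ ↦ (phi A m t : ℂ) * Complex.exp (s * t) := by
  -- `φ` vanishes off `K = [−R, R]`, where `e^{st}` is bounded
  set R : ℝ := ((m : ℝ) + 1) / A with hR
  have heq : (fun t : ℝ ↦ (phi A m t : ℂ) * Complex.exp (s * t)) =
      fun t : ℝ ↦ (phi A m t : ℂ) * (Icc (-R) R).indicator (fun t : ℝ ↦ Complex.exp (s * t)) t := by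
    funext t
    by_cases ht : t ∈ Icc (-R) R
    · rw [Set.indicator_of_mem ht]
    · rw [Set.indicator_of_notMem ht, phi_eq_zero_of_lt hA m (by
        rw [mem_Icc, ← abs_le, not_le] at ht; exact ht)]
      simp
  rw [heq]
  refine Integrable.mul_bdd (c := Real.exp (‖s‖ * R)) (integrable_phi A m).ofReal
    ((Continuous.aestronglyMeasurable (by fun_prop)).indicator measurableSet_Icc) (Eventually.of_forall fun t ↦ ?_)
  rw [Set.indicator_apply]
  split_ifs with ht
  · rw [mem_Icc, ← abs_le] at ht
    rw [Complex.norm_exp]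
    refine Real.exp_le_exp.mpr ?_
    calc (s * (t : ℂ)).re ≤ ‖s * (t : ℂ)‖ := Complex.re_le_norm _
      _ = ‖s‖ * |t| := by rw [norm_mul, Complex.norm_real, Real.norm_eq_abs]
      _ ≤ ‖s‖ * R := mul_le_mul_of_nonneg_left ht (norm_nonneg _)
  · rw [norm_zero]; positivity

/-- **The Laplace transform of the box**: `∫ φ₁(u) e^{su} du = sinh(s/A)/(s/A)`. [folklore] -/
theorem integral_box_mul_exp (hA : 0 < A) (s : ℂ) :
    ∫ u, (box A u : ℂ) * Complex.exp (s * u) = laplaceFactor A s := by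
  have hA0 : A ≠ 0 := hA.ne'
  have e : (fun u : ℝ ↦ (box A u : ℂ) * Complex.exp (s * u)) =
      (Icc (-A⁻¹) A⁻¹).indicator fun u : ℝ ↦ (A / 2 : ℂ) * Complex.exp (s * u) := by
    funext u
    rw [box_eq_indicator, Set.indicator_apply, Set.indicator_apply]
    split_ifs <;> simp
  rw [e, MeasureTheory.integral_indicator measurableSet_Icc, integral_Icc_eq_integral_Ioc,
    ← intervalIntegral.integral_of_le (by have := inv_pos.mpr hA; linarith),
    intervalIntegral.integral_const_mul, laplaceFactor]
  by_cases hs : s = 0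
  · subst hs
    simp only [zero_mul, Complex.exp_zero, if_true, intervalIntegral.integral_const]
    rw [show A⁻¹ - -A⁻¹ = 2 * A⁻¹ by ring, Complex.real_smul]
    push_cast
    field_simp
    exact div_self (by exact_mod_cast hA0)
  · rw [if_neg hs, integral_exp_mul_complex hs, Complex.sinh]
    have hsA : s / A ≠ 0 := div_ne_zero hs (by exact_mod_cast hA0)
    push_cast
    field_simp

/-- **The Laplace transform of a convolution step**: if `∫ g(u)e^{su} du = G` then
`∫ (φ₁ * g)(u) e^{su} du = (sinh(s/A)/(s/A)) · G`, for `g = φ_{m+1}`. [folklore] -/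
theorem integral_phi_succ_mul_exp (hA : 0 < A) (m : ℕ) (s : ℂ) :
    ∫ u, (phi A (m + 1) u : ℂ) * Complex.exp (s * u) =
      laplaceFactor A s * ∫ u, (phi A m u : ℂ) * Complex.exp (s * u) := by
  -- twisted functions
  set F : ℝ → ℂ := fun t ↦ (box A t : ℂ) * Complex.exp (s * t) with hF
  set G : ℝ → ℂ := fun t ↦ (phi A m t : ℂ) * Complex.exp (s * t) with hG
  have hFi : Integrable F := integrable_phi_mul_exp hA 0 s
  have hGi : Integrable G := integrable_phi_mul_exp hA m s
  -- `(F ⋆ G)(x) = e^{sx} (φ₁ ⋆ φ)(x)`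
  have hconv : ∀ x : ℝ, (F ⋆[ContinuousLinearMap.mul ℝ ℂ] G) x =
      (phi A (m + 1) x : ℂ) * Complex.exp (s * x) := by
    intro x
    rw [convolution_def, phi_succ_apply, ← integral_complex_ofReal, ← MeasureTheory.integral_mul_const]
    refine integral_congr_ae (Eventually.of_forall fun t ↦ ?_)
    simp only [hF, hG, ContinuousLinearMap.mul_apply']
    push_cast
    rw [show Complex.exp (s * ((x : ℂ) - t)) = Complex.exp (-(s * t) + s * (x : ℂ)) by ring_nf,
      Complex.exp_add, Complex.exp_neg]
    have hne : Complex.exp (s * (t : ℂ)) ≠ 0 := Complex.exp_ne_zero _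
    field_simp
  have h1 : ∫ x, (F ⋆[ContinuousLinearMap.mul ℝ ℂ] G) x = (∫ x, F x) * ∫ x, G x :=
    integral_convolution (L := ContinuousLinearMap.mul ℝ ℂ) hFi hGi
  simp_rw [hconv] at h1
  rw [h1, hF, integral_box_mul_exp hA s]

/-- **The Laplace transform of Weiss's kernel**: `∫ φ_{m+1}(u) e^{su} du = (sinh(s/A)/(s/A))^{m+1}`
for every `s ∈ ℂ` (an entire function of `s`). [cite: ThornerZaman2017, Lemma 4.3] -/
theorem integral_phi_mul_exp (hA : 0 < A) (s : ℂ) : ∀ m,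
    ∫ u, (phi A m u : ℂ) * Complex.exp (s * u) = laplaceFactor A s ^ (m + 1)
  | 0 => by rw [zero_add, pow_one]; exact integral_box_mul_exp hA s
  | m + 1 => by rw [integral_phi_succ_mul_exp hA m s, integral_phi_mul_exp hA s m]; ring

/-! ### Bounds for `sinh(s/A)/(s/A)` -/

/-- **`|sinh(s/A)/(s/A)| ≤ e^{|Re s|/A}`** (from `sinh(s/A)/(s/A) = ∫ φ₁(u)e^{su} du` and
`|e^{su}| ≤ e^{|Re s|/A}` on the support). [cite: ThornerZaman2017, Lemma 4.3 (iii)] -/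
theorem norm_laplaceFactor_le_exp (hA : 0 < A) (s : ℂ) :
    ‖laplaceFactor A s‖ ≤ Real.exp (|s.re| / A) := by
  rw [← integral_box_mul_exp hA s]
  refine (MeasureTheory.norm_integral_le_integral_norm _).trans ?_
  have hbound : ∀ u, ‖(box A u : ℂ) * Complex.exp (s * u)‖ ≤ box A u * Real.exp (|s.re| / A) := by
    intro u
    rw [norm_mul, Complex.norm_real, Real.norm_eq_abs, abs_of_nonneg (box_nonneg hA u), Complex.norm_exp]
    by_cases hu : |u| ≤ A⁻¹
    · refine mul_le_mul_of_nonneg_left (Real.exp_le_exp.mpr ?_) (box_nonneg hA u)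
      have : (s * (u : ℂ)).re = s.re * u := by simp [Complex.mul_re]
      rw [this, div_eq_mul_inv]
      calc s.re * u ≤ |s.re * u| := le_abs_self _
        _ = |s.re| * |u| := abs_mul _ _
        _ ≤ |s.re| * A⁻¹ := mul_le_mul_of_nonneg_left hu (abs_nonneg _)
    · rw [box_eq_zero A (not_le.mp hu), zero_mul, zero_mul]
  calc ∫ u, ‖(box A u : ℂ) * Complex.exp (s * u)‖ ≤ ∫ u, box A u * Real.exp (|s.re| / A) :=
        integral_mono_of_nonneg (Eventually.of_forall fun u ↦ norm_nonneg _)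
          ((integrable_box A).mul_const _) (Eventually.of_forall hbound)
    _ = Real.exp (|s.re| / A) := by rw [integral_mul_const, integral_box hA, one_mul]

/-- `|sinh z| ≤ e^{|Re z|}`. [folklore] -/
theorem norm_sinh_le (z : ℂ) : ‖Complex.sinh z‖ ≤ Real.exp |z.re| := by
  rw [Complex.sinh]
  calc ‖(Complex.exp z - Complex.exp (-z)) / 2‖ = ‖Complex.exp z - Complex.exp (-z)‖ / 2 := by
        rw [norm_div]; norm_num
    _ ≤ (‖Complex.exp z‖ + ‖Complex.exp (-z)‖) / 2 := by gcongr; exact norm_sub_le _ _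
    _ ≤ (Real.exp |z.re| + Real.exp |z.re|) / 2 := by
        rw [Complex.norm_exp, Complex.norm_exp, Complex.neg_re]
        gcongr
        · exact le_abs_self _
        · exact neg_le_abs _
    _ = Real.exp |z.re| := by ring

/-- **`|sinh(s/A)/(s/A)| ≤ (A/|s|) e^{|Re s|/A}`** for `s ≠ 0`. [cite: ThornerZaman2017, Lemma 4.3 (iii)] -/
theorem norm_laplaceFactor_le_div (hA : 0 < A) {s : ℂ} (hs : s ≠ 0) :
    ‖laplaceFactor A s‖ ≤ A / ‖s‖ * Real.exp (|s.re| / A) := by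
  rw [laplaceFactor, if_neg hs, norm_div, norm_div, Complex.norm_real, Real.norm_eq_abs, abs_of_pos hA,
    div_div_eq_mul_div]
  have hsA : (s / A).re = s.re / A := by simp [Complex.div_ofReal_re]
  calc ‖Complex.sinh (s / A)‖ * A / ‖s‖ ≤ Real.exp |(s / (A : ℂ)).re| * A / ‖s‖ := by
        gcongr; exact norm_sinh_le _
    _ = A / ‖s‖ * Real.exp (|s.re| / A) := by rw [hsA, abs_div, abs_of_pos hA]; ring

/-- Powers: `|(sinh(s/A)/(s/A))^k| ≤ e^{k|Re s|/A}`. [cite: ThornerZaman2017, Lemma 4.3 (iii)] -/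
theorem norm_laplaceFactor_pow_le_exp (hA : 0 < A) (s : ℂ) (k : ℕ) :
    ‖laplaceFactor A s ^ k‖ ≤ Real.exp (k * |s.re| / A) := by
  rw [norm_pow, mul_div_assoc, Real.exp_nat_mul]
  exact pow_le_pow_left₀ (norm_nonneg _) (norm_laplaceFactor_le_exp hA s) k

/-- Powers: `|(sinh(s/A)/(s/A))^k| ≤ (A/|s|)^k e^{k|Re s|/A}` (`s ≠ 0`). [cite: ThornerZaman2017, Lemma 4.3 (iii)] -/
theorem norm_laplaceFactor_pow_le_div (hA : 0 < A) {s : ℂ} (hs : s ≠ 0) (k : ℕ) :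
    ‖laplaceFactor A s ^ k‖ ≤ (A / ‖s‖) ^ k * Real.exp (k * |s.re| / A) := by
  rw [norm_pow, mul_div_assoc, Real.exp_nat_mul, ← mul_pow]
  exact pow_le_pow_left₀ (norm_nonneg _) (norm_laplaceFactor_le_div hA hs) k

/-! ### On the imaginary axis -/

/-- **On the imaginary axis**: `sinh(it/A)/(it/A) = sin(t/A)/(t/A)` (real), `t ≠ 0`. [folklore] -/
theorem laplaceFactor_mul_I (hA : 0 < A) {t : ℝ} (ht : t ≠ 0) :
    laplaceFactor A (t * I) = ((Real.sin (t / A) / (t / A) : ℝ) : ℂ) := by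
  have hA0 : (A : ℂ) ≠ 0 := by exact_mod_cast hA.ne'
  have htI : (t : ℂ) * I ≠ 0 := mul_ne_zero (by exact_mod_cast ht) Complex.I_ne_zero
  rw [laplaceFactor, if_neg htI]
  have e1 : (t : ℂ) * I / A = (t / A : ℝ) * I := by push_cast; ring
  rw [e1, Complex.sinh_mul_I]
  push_cast
  rw [mul_div_mul_right _ _ Complex.I_ne_zero]

/-- **Lower bound on the imaginary axis**: `1 − (t/A)²/6 ≤ sin(t/A)/(t/A)` for `0 < |t| ≤ A`
(from `x − x³/6 < sin x`, `0 < x ≤ 1`; the function is even). [folklore] -/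
theorem one_sub_le_sin_div {x : ℝ} (hx : x ≠ 0) : 1 - x ^ 2 / 6 ≤ Real.sin x / x := by
  rcases lt_or_gt_of_ne hx with h | h
  · -- `x < 0`: use evenness
    have h' : 0 < -x := by linarith
    have := Real.sin_gt_sub_cube h'
    rw [Real.sin_neg] at this
    rw [le_div_iff_of_neg h]
    nlinarith
  · have := Real.sin_gt_sub_cube h
    rw [le_div_iff₀ h]
    nlinarith

/-- **`|Ψ̂(it)| ≥ 1/2` for `|t| ≤ T` when `(m+1)T² ≤ 3A²`**: `sin(t/A)/(t/A) ≥ 1 − (t/A)²/6` and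
Bernoulli's inequality. [cite: ThornerZaman2017, Lemma 4.3 (vi)] -/
theorem half_le_norm_laplaceFactor_pow (hA : 0 < A) (m : ℕ) {T : ℝ}
    (hTA : ((m : ℝ) + 1) * T ^ 2 ≤ 3 * A ^ 2) {t : ℝ} (ht : |t| ≤ T) :
    1 / 2 ≤ ‖laplaceFactor A (t * I) ^ (m + 1)‖ := by
  by_cases ht0 : t = 0
  · subst ht0; simp [laplaceFactor]; norm_num
  rw [laplaceFactor_mul_I hA ht0, norm_pow, Complex.norm_real, Real.norm_eq_abs]
  set r : ℝ := Real.sin (t / A) / (t / A) with hr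
  have hx : t / A ≠ 0 := div_ne_zero ht0 hA.ne'
  have h1 : 1 - (t / A) ^ 2 / 6 ≤ r := one_sub_le_sin_div hx
  have ht2 : t ^ 2 ≤ T ^ 2 := by rw [← sq_abs t, ← sq_abs T]; exact pow_le_pow_left₀ (abs_nonneg _) (ht.trans (le_abs_self T)) 2
  have hm1 : (1 : ℝ) ≤ (m : ℝ) + 1 := by have := Nat.cast_nonneg (α := ℝ) m; linarith
  have hTA' : T ^ 2 ≤ 3 * A ^ 2 := by nlinarith
  have hA2 : 0 < A ^ 2 := by positivity
  have htA : (t / A) ^ 2 = t ^ 2 / A ^ 2 := by rw [div_pow]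
  have ha : -(1 / 2 : ℝ) ≤ -((t / A) ^ 2 / 6) := by
    rw [htA, neg_le_neg_iff, div_le_iff₀ (by norm_num : (0 : ℝ) < 6), div_le_iff₀ hA2]; nlinarith
  have hr0 : 0 ≤ r := by linarith
  -- Bernoulli
  have hB := one_add_mul_le_pow (a := -((t / A) ^ 2 / 6)) (by linarith) (m + 1)
  have hpow : (1 + -((t / A) ^ 2 / 6)) ^ (m + 1) ≤ r ^ (m + 1) :=
    pow_le_pow_left₀ (by linarith) (by linarith) _
  have hlin : (1 : ℝ) / 2 ≤ 1 + (m + 1 : ℕ) * -((t / A) ^ 2 / 6) := by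
    push_cast
    rw [htA]
    have : ((m : ℝ) + 1) * (t ^ 2 / A ^ 2) ≤ 3 := by
      rw [mul_div_assoc', div_le_iff₀ hA2]; nlinarith
    linarith
  rw [abs_of_nonneg hr0]
  linarith

/-- **Gallagher's inequality with Weiss's kernel** (Weiss 1983, Cor. 3.3; Thorner–Zaman Lemma 4.3 (vi)):
for `A > 0`, `(m+1)T² ≤ 3A²`, finitely many frequencies `c_j ∈ ℝ` and coefficients `b_j ∈ ℂ`,
`∫_{−T}^{T} |Σ_j b_j e^{−itc_j}|² dt ≤ 8π ∫_ℝ |Σ_j b_j φ_{m+1}(u − c_j)|² du`.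
Proof: `g(u) = Σ b_j φ_{m+1}(u − c_j)` has `𝓕g(ξ) = Ψ̂(−2πiξ) Σ b_j e^{−2πiξc_j}`; Plancherel and
`|Ψ̂(it)|² ≥ 1/4` for `|t| ≤ T`. [cite: ThornerZaman2017, Lemma 4.3 (vi)] -/
theorem gallagher (hA : 0 < A) (m : ℕ) {T : ℝ} (hT : 0 < T) (hTA : ((m : ℝ) + 1) * T ^ 2 ≤ 3 * A ^ 2)
    {ι : Type*} (J : Finset ι) (b : ι → ℂ) (c : ι → ℝ) :
    ∫ t in -T..T, ‖∑ j ∈ J, b j * Complex.exp (-(t * c j) * I)‖ ^ 2 ≤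
      8 * π * ∫ u, ‖∑ j ∈ J, b j * (phi A m (u - c j) : ℂ)‖ ^ 2 := by
  classical
  set g : ℝ → ℂ := fun u ↦ ∑ j ∈ J, b j * (phi A m (u - c j) : ℂ) with hg
  set S : ℝ → ℂ := fun t ↦ ∑ j ∈ J, b j * Complex.exp (-(t * c j) * I) with hS
  -- `g ∈ L¹ ∩ L²`
  have hgi : Integrable g := by
    refine integrable_finsetSum _ fun j _ ↦ Integrable.const_mul ?_ _
    exact ((integrable_phi A m).comp_sub_right (c j)).ofReal
  set C : ℝ := ∑ j ∈ J, ‖b j‖ * (A / 2) with hC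
  have hgb : ∀ u, ‖g u‖ ≤ C := fun u ↦ by
    refine (norm_sum_le _ _).trans (Finset.sum_le_sum fun j _ ↦ ?_)
    rw [norm_mul, Complex.norm_real, Real.norm_eq_abs, abs_of_nonneg (phi_nonneg hA m _)]
    exact mul_le_mul_of_nonneg_left (phi_le hA m _) (norm_nonneg _)
  have hg2 : MemLp g 2 := by
    rw [memLp_two_iff_integrable_sq_norm hgi.aestronglyMeasurable]
    refine (hgi.norm.const_mul C).mono' (hgi.aestronglyMeasurable.norm.pow 2) (Eventually.of_forall fun u ↦ ?_)
    rw [Real.norm_eq_abs, abs_of_nonneg (by positivity), sq]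
    exact mul_le_mul_of_nonneg_right (hgb u) (norm_nonneg _)
  -- the Fourier transform
  have hF : ∀ ξ : ℝ, 𝓕 g ξ = laplaceFactor A (-(2 * π * ξ) * I) ^ (m + 1) * S (2 * π * ξ) := by
    intro ξ
    rw [Real.fourier_real_eq_integral_exp_smul]
    simp only [hg, smul_eq_mul, Finset.mul_sum]
    rw [integral_finsetSum _ (fun j _ ↦ ?_)]
    · rw [hS]; dsimp only
      rw [Finset.mul_sum]
      refine Finset.sum_congr rfl fun j _ ↦ ?_
      -- translate: `v = w + c_j`
      have hsub := integral_add_right_eq_self (μ := volume)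
        (fun v : ℝ ↦ Complex.exp (↑(-2 * π * v * ξ) * I) * (b j * (phi A m (v - c j) : ℂ))) (c j)
      rw [← hsub]
      simp only [add_sub_cancel_right]
      have e : ∀ w : ℝ, Complex.exp (↑(-2 * π * (w + c j) * ξ) * I) * (b j * (phi A m w : ℂ)) =
          b j * Complex.exp (-(2 * π * ξ * c j) * I) * ((phi A m w : ℂ) * Complex.exp (-(2 * π * ξ) * I * w)) := by
        intro w
        have : Complex.exp (↑(-2 * π * (w + c j) * ξ) * I) =
            Complex.exp (-(2 * π * ξ * c j) * I) * Complex.exp (-(2 * π * ξ) * I * w) := by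
          rw [← Complex.exp_add]; push_cast; ring_nf
        rw [this]; ring
      simp_rw [e]
      rw [MeasureTheory.integral_const_mul, integral_phi_mul_exp hA _ m]
      push_cast
      ring
    · refine Integrable.bdd_mul (c := 1) ?_ (Continuous.aestronglyMeasurable (by fun_prop))
        (Eventually.of_forall fun v ↦ ?_)
      · exact (((integrable_phi A m).comp_sub_right (c j)).ofReal).const_mul _
      · rw [Complex.norm_exp_ofReal_mul_I]
  -- Plancherel
  have hP := Literature.Analysis.FunctionSpaces.integral_norm_sq_fourierIntegral_eq hgi hg2
  -- lower bound for `∫ |𝓕 g|²`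
  have hFi : Integrable fun ξ : ℝ ↦ ‖𝓕 g ξ‖ ^ 2 := by
    have := Literature.Analysis.FunctionSpaces.memLp_two_fourierIntegral hgi hg2
    exact (memLp_two_iff_integrable_sq_norm this.1).1 this
  have hSc : Continuous S := by
    refine continuous_finsetSum _ fun j _ ↦ ?_
    fun_prop
  set a : ℝ := T / (2 * π) with ha
  have hπ : 0 < 2 * π := by positivity
  have ha0 : 0 < a := div_pos hT hπ
  have hkey : ∀ ξ ∈ Icc (-a) a, (1 / 4 : ℝ) * ‖S (2 * π * ξ)‖ ^ 2 ≤ ‖𝓕 g ξ‖ ^ 2 := by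
    intro ξ hξ
    rw [hF, norm_mul, mul_pow]
    refine mul_le_mul_of_nonneg_right ?_ (by positivity)
    have habs : |(-(2 * π * ξ))| ≤ T := by
      rw [abs_neg, abs_mul, abs_of_pos hπ]
      rw [mem_Icc, ← abs_le] at hξ
      calc 2 * π * |ξ| ≤ 2 * π * a := by gcongr
        _ = T := by rw [ha]; field_simp
    have h := half_le_norm_laplaceFactor_pow hA m hTA habs
    have e : ((-(2 * π * ξ) : ℝ) : ℂ) * I = -(2 * π * (ξ : ℂ)) * I := by push_cast; ring
    rw [e] at h
    nlinarith [norm_nonneg (laplaceFactor A (-(2 * π * (ξ : ℂ)) * I) ^ (m + 1))]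
  have hlow : ∫ ξ in Icc (-a) a, (1 / 4 : ℝ) * ‖S (2 * π * ξ)‖ ^ 2 ≤ ∫ ξ, ‖𝓕 g ξ‖ ^ 2 := by
    calc ∫ ξ in Icc (-a) a, (1 / 4 : ℝ) * ‖S (2 * π * ξ)‖ ^ 2 ≤ ∫ ξ in Icc (-a) a, ‖𝓕 g ξ‖ ^ 2 := by
          refine setIntegral_mono_on ?_ hFi.integrableOn measurableSet_Icc hkey
          exact (Continuous.integrableOn_Icc (by fun_prop))
      _ ≤ ∫ ξ, ‖𝓕 g ξ‖ ^ 2 := setIntegral_le_integral hFi (Eventually.of_forall fun ξ ↦ by positivity)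
  -- change of variables `t = 2πξ`
  have hcv : ∫ ξ in Icc (-a) a, (1 / 4 : ℝ) * ‖S (2 * π * ξ)‖ ^ 2 =
      (1 / 4) * (2 * π)⁻¹ * ∫ t in -T..T, ‖S t‖ ^ 2 := by
    rw [integral_Icc_eq_integral_Ioc, ← intervalIntegral.integral_of_le (by linarith),
      intervalIntegral.integral_const_mul,
      intervalIntegral.integral_comp_mul_left (fun t ↦ ‖S t‖ ^ 2) hπ.ne', smul_eq_mul]
    have e1 : 2 * π * -a = -T := by rw [ha]; field_simp
    have e2 : 2 * π * a = T := by rw [ha]; field_simp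
    rw [e1, e2]; ring
  rw [hcv] at hlow
  rw [← hP]
  have : ∫ t in -T..T, ‖S t‖ ^ 2 = 8 * π * ((1 / 4) * (2 * π)⁻¹ * ∫ t in -T..T, ‖S t‖ ^ 2) := by
    field_simp; ring
  rw [this]
  exact mul_le_mul_of_nonneg_left hlow (by positivity)

end Literature.NumberTheory.LFunctions.WeissKernel

end
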